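import Literature.NumberTheory.DiophantineGeometry.GenEllThm21
import Literature.NumberTheory.DiophantineGeometry.GenEllProjLineExamples
import HarnessLib

/-!
# [GenEll] Theorem 2.1 — kernel witness that the RETIRED transcription `GenEll_thm21` is abc-strength

S. Mochizuki, *Arithmetic elliptic curves in general position*, Math. J. Okayama Univ. 52 (2010) 1–28
[cite: MochizukiGenEll2010, Thm 2.1 p.11]: "Let `Σ` be a finite set of **prime numbers**. … (i) ⟺ (ii)".

Proof-only companion of `GenEllThm21.lean` (abc-iut cell, seat abc-iut-w5-d135; FACT-LIST soundness
finding «B10-3 addendum», HOME/INBOX 2026-08-26T00:01Z).  The declaration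
`GenEll.GenEll_thm21 : Prop` of that file DROPS the printed binder "of prime numbers" (audit A-Sd2-F1;
its docstring says «RETIRED — DO NOT CONSUME … ABC-STRENGTH AS TYPED»).  This file makes that sentence
a KERNEL THEOREM, so that no fact list can class `GenEll_thm21` as an admissible "published
prerequisite":

* `abcCompactlyBounded_of_not_prime_mem` — for a finite set `S ∋ n` with `n` NOT prime, statement (ii)
  `ABCCompactlyBounded S` holds VACUOUSLY (no compactly bounded datum has support ⊇ `S`, because
  `CBData.primes_prime` makes every support element prime);
* `vojtaP1Deg_of_genEll_thm21` — hence `GenEll_thm21 → ∀ d > 0, VojtaP1Deg d` (take `Σ := {4}`),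
  i.e. the retired transcription yields statement (i)|_{ℙ¹} OUTRIGHT;
* `abc_of_genEll_thm21` — hence the abc sentence of Masser–Oesterlé outright (via the landed
  dictionary `GenEll.abc_of_vojtaP1Deg`).

The FAITHFUL transcription `GenEll.GenEll_thm21_primes` (binder `∀ p ∈ Σ, p.Prime`) is untouched: at a
set of primes the vacuity disappears (`GenEllProjLineExamples.exists_cbData_supportContains`).
Nothing here asserts abc or takes a side on [IUTchIII] Cor. 3.12; these are statements about OUR
typed interface. [cite: MochizukiGenEll2010, Thm 2.1 p.11]
-/

namespace Literature.NumberTheory.DiophantineGeometry.GenEll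

/-- **Vacuity of statement (ii) at a non-prime support element.** If the finite set `S` contains a
natural number `n` that is not prime, then `ABCCompactlyBounded S` holds vacuously: a compactly
bounded datum `D : CBData` with `D.SupportContains S` (`S ⊆ D.primes`) would make `n` prime by
`CBData.primes_prime`. (Audit A-Sd2-F1, kernel form.) [cite: MochizukiGenEll2010, Thm 2.1 (ii) p.11] -/
theorem abcCompactlyBounded_of_not_prime_mem {S : Finset ℕ} {n : ℕ} (hn : n ∈ S) (hnp : ¬ n.Prime) :
    ABCCompactlyBounded S := by
  intro d _ ε _ D hD
  exact absurd (D.primes_prime n (hD hn)) hnp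

/-- `ABCCompactlyBounded {4}` holds vacuously (`4` is not prime). [cite: MochizukiGenEll2010, Thm 2.1 (ii) p.11] -/
theorem abcCompactlyBounded_four : ABCCompactlyBounded ({4} : Finset ℕ) :=
  abcCompactlyBounded_of_not_prime_mem (Finset.mem_singleton_self 4) (by decide)

/-- **The retired transcription `GenEll_thm21` is (i)|_{ℙ¹}-strength**: it yields statement (i) of
[GenEll] Thm. 2.1 for `(ℙ¹_ℚ, [0]+[1]+[∞])` and every positive degree bound `d` OUTRIGHT, by
specialising its set binder to `Σ := {4}` where (ii) is vacuous. [cite: MochizukiGenEll2010, Thm 2.1 p.11] -/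
theorem vojtaP1Deg_of_genEll_thm21 (h : GenEll_thm21) : ∀ d : ℕ, 0 < d → VojtaP1Deg d :=
  h {4} abcCompactlyBounded_four

/-- **… hence abc-strength**: `GenEll_thm21` implies the abc sentence of Masser–Oesterlé (strong form:
`∀ ε > 0, ∃ C > 0, ∀ abc triples, c < C · rad(abc)^{1+ε}`) outright, via the landed dictionary
`abc_of_vojtaP1Deg`. Consequently `GenEll_thm21` must never be classed as an admissible fact; the
faithful fact is `GenEll_thm21_primes`. [cite: MochizukiGenEll2010, Thm 2.1 p.11] -/
theorem abc_of_genEll_thm21 (h : GenEll_thm21) :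
    ∀ ε : ℝ, 0 < ε → ∃ C : ℝ, 0 < C ∧
      ∀ a b c : ℕ, IsABCTriple a b c → (c : ℝ) < C * ((rad a b c : ℕ) : ℝ) ^ (1 + ε) :=
  abc_of_vojtaP1Deg (vojtaP1Deg_of_genEll_thm21 h)

end Literature.NumberTheory.DiophantineGeometry.GenEll
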